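import Literature.NumberTheory.EllipticCurves.PAdicLFunctionTameDepletionFactorProofs
import Summits.BirchSwinnertonDyer.BirchSwinnertonDyer.Theorems.EisensteinDepletionAtTwoStarSmoothedMeasure
import Summits.BirchSwinnertonDyer.BirchSwinnertonDyer.Theorems.EisensteinDepletionAtTwoStarLevelElement
import HarnessLib

/-!
# Route `EisensteinDepletionAtTwo`, crux E1M `DepletedLambdaLawAtTwoMod` (item stmt-BirchSwinnertonDyer-20341),
# line `star` — **(★-EisFin): the Eisenstein half of (★) in FINITE-LEVEL form** (`starEisFin`)

Cell `bsd-rank2`, seat `bsd-rank2-eng-2` GEN 8. THEOREMS ONLY — no definition, no named fact, no `sorry`. HONEST FRAMING: pure `2`-adic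
analysis of Dedekind–Rademacher sums, no elliptic curve; this is the finite-level REPLACEMENT of the registered analytic stub
`stub_starEisNorm : StarEisNorm` of `Cruxes/DepletedLambdaLawAtTwoMod/Lines/star.lean` proposed in evidence #39 on the item (memo
`EISNORM-FINITE-LEVEL-eng2g8.md`; endorsed by lit GEN 21): instead of the coefficientwise `2`-adic CONVERGENCE of the Riemann sums of
the (non-distribution) `C`-normalised measure, it proves that the Riemann sums of its STEVENS SMOOTHING in the `8`-normalisation are
eventually congruent modulo `2ℤ₂` to the coefficients of an explicit `H ∈ Λ` whose reduction is the right-hand side of (★-core) up to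
the unit `(1+T)^e`. With a mod-2 cusp congruence in the `8`-normalisation (the research stub (★-SymbC′)) and the transform of
`Sm_5^5 μ_f` (curve side; `red(1 − 5(1+T)^{±1}) = T·unit` supplies the `T²` of (★)) this closes (★-core) — the glue is a separate file.
Nothing here reads an analytic rank; (★)/(★-SymbC)/E1M are NOT proved; BSD is not proved by any of this (PARTITION D-0054: none —
r_an ≥ 2 axis S0, door T-r3₂).

* `norm_distributionRiemannSum_stevensSmoothing_add_le`: `‖RS_k(Sm ν₈)(n) + (3/4)·RS_k(Sm E)(n)‖₂ ≤ 2⁻¹` for `n ≥ 2`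
  (η = −1 half vanishes; `Sm E` even; pointwise estimate of `…StarSmoothedMeasure`).
* **`starEisFin`**: `∃ H e`, (i) `∀ k, ∀ᶠ n, ‖RS_k(stevensSmoothing 5 (eisNormMeasure N β 8))(n) − [T^k] ι H‖₂ ≤ 2⁻¹`,
  (ii) `red H = red((1+T)^e)·red(pfree G₀)·red(pfree G₀^ι)·∏_{ℓ∣N} red(γ_ℓ−1)^{ord_ℓ N}` — with `H = L_Λ·½G^ι·½G`
  (`exists_iwasawa_half_klTwoNumerator(Inv)`, `red_levelElement`, `red_pfree_eq_red_two`), `L(Sm E) = 4·ιH`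
  (`distributionTransform_smoothedEisensteinDedekindTwo` with the Teichmüller–exponent data `exists_teichmuller_frobeniusExponent`),
  `tendsto_distributionRiemannSum` for the bounded distribution `Sm E`.
Numerics (exact, evidence #39): `Θ(Sm ν₈) = L̄·Θ⁺(½G^ι)·Θ⁺(½G)` in `𝔽₂[Γ_n]` coefficient by coefficient for N ∈ {15,21,33,45,63}, n ≤ 6.

References: G. Stevens, *Arithmetic on Modular Curves* (1982), §5.4 Prop. 5.4.1, PDF p. 74 [Stevens1982]; B. Mazur, J. Tate,
J. Teitelbaum, Invent. Math. 84 (1986), §I.10–I.13 [MazurTateTeitelbaum1986Invent]; R. Greenberg, V. Vatsal, Invent. Math. 142 (2000),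
§3 Thm. (3.12), (28) [GreenbergVatsal2000].
-/

set_option linter.dupNamespace false
set_option autoImplicit false

noncomputable section

open scoped Classical

namespace Summit.BirchSwinnertonDyer.BirchSwinnertonDyer.Theorems.DepletionAtTwo

section RiemannSums

variable {N : ℕ} {β : ℕ → ℕ}

open Literature.NumberTheory.EllipticCurves Literature.NumberTheory.EllipticCurves.GreenbergVatsal2000 Filter Topology

/-- **Riemann sums.** For `n ≥ 2` and every `k`:
`‖RS_k(Sm_5^5 ν₈)(n) + (3/4)·RS_k(Sm_5^5 E_{N.divisors,c})(n)‖₂ ≤ 2⁻¹` (the `η = −1` half of `Sm ν₈` vanishes, `Sm E` is even so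
its full Riemann sum is twice its `η = +1` half, and the pointwise estimate holds on every class `5^s`).
[cite: MazurTateTeitelbaum1986Invent, §I.13] [cite: Stevens1982, §5.4 (PDF p. 73)] -/
theorem norm_distributionRiemannSum_stevensSmoothing_add_le (hodd : Odd N) (hadm : IsAdmissibleStabData N β)
    (k : ℕ) {n : ℕ} (hn : 2 ≤ n) :
    ‖distributionRiemannSum (stevensSmoothing 5 (eisNormMeasure N β 8)) k n +
        (3 / 4 : ℚ_[2]) * distributionRiemannSum (smoothedEisensteinDedekindTwo N.divisors (stabCoeff N β)) k n‖ ≤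
      2⁻¹ := by
  haveI : NeZero (2 ^ n) := ⟨pow_ne_zero _ two_ne_zero⟩
  rw [distributionRiemannSum_two_eq_add (stevensSmoothing 5 (eisNormMeasure N β 8)) k n,
    distributionRiemannSum_two_of_even (smoothedEisensteinDedekindTwo_neg N.divisors (stabCoeff N β)) k n]
  have hneg : ∑ s : ZMod (2 ^ n), stevensSmoothing 5 (eisNormMeasure N β 8) (n + 2)
      (-((cyclotomicGenerator 2 : ZMod (2 ^ (n + 2))) ^ s.val)) * (s.val.choose k : ℚ_[2]) = 0 := by
    refine Finset.sum_eq_zero fun s _ ↦ ?_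
    rw [stevensSmoothing_eisNormMeasure_of_not 8 _ (fun h ↦ ?_), zero_mul]
    have := val_neg_cyclotomicGenerator_pow_mod_four n s.val
    omega
  rw [hneg, add_zero, ← mul_assoc, show (3 / 4 : ℚ_[2]) * 2 = 3 / 2 by norm_num, Finset.mul_sum,
    ← Finset.sum_add_distrib]
  refine IsUltrametricDist.norm_sum_le_of_forall_le_of_nonneg (by norm_num) fun s _ ↦ ?_
  rw [← mul_assoc, ← add_mul, norm_mul]
  have h1 := norm_stevensSmoothing_eisNormMeasure_add_le hodd hadm (by omega : 4 ≤ n + 2)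
    ((cyclotomicGenerator 2 : ZMod (2 ^ (n + 2))) ^ s.val) (val_cyclotomicGenerator_pow_mod_four n s.val)
  have h2 : ‖((s.val.choose k : ℕ) : ℚ_[2])‖ ≤ 1 := by exact_mod_cast Padic.norm_int_le_one (p := 2) (s.val.choose k)
  calc ‖stevensSmoothing 5 (eisNormMeasure N β 8) (n + 2) ((cyclotomicGenerator 2 : ZMod (2 ^ (n + 2))) ^ s.val) +
          3 / 2 * smoothedEisensteinDedekindTwo N.divisors (stabCoeff N β) (n + 2)
            ((cyclotomicGenerator 2 : ZMod (2 ^ (n + 2))) ^ s.val)‖ * ‖((s.val.choose k : ℕ) : ℚ_[2])‖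
      ≤ 2⁻¹ * 1 := mul_le_mul h1 h2 (norm_nonneg _) (by norm_num)
    _ = 2⁻¹ := mul_one _

end RiemannSums


section Main

variable {N : ℕ} {β : ℕ → ℕ}

open Literature.NumberTheory.EllipticCurves Literature.NumberTheory.EllipticCurves.GreenbergVatsal2000
  Literature.NumberTheory.EllipticCurves.CyclotomicZp Filter Topology
  Summit.BirchSwinnertonDyer.Rank1Residual.X1.MuLambda

/-- `red G₀ ≠ 0` for `G₀ ∈ Λ` with constant term `1`. [folklore] -/
theorem red_ne_zero_of_constantCoeff_eq_one {G : IwasawaAlgebra 2} (h : PowerSeries.constantCoeff G = 1) : red G ≠ 0 := by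
  intro h0
  have h1 : PowerSeries.constantCoeff (red G) = 1 := by
    rw [red, ← PowerSeries.coeff_zero_eq_constantCoeff_apply, PowerSeries.coeff_map,
      PowerSeries.coeff_zero_eq_constantCoeff_apply, h, map_one]
  rw [h0, map_zero] at h1
  exact zero_ne_one h1

/-- The coefficients of `ι H`, `H ∈ Λ`, have norm `≤ 1`. [folklore] -/
theorem norm_coeff_iwasawaToPowerSeries_le_one (H : IwasawaAlgebra 2) (k : ℕ) :
    ‖PowerSeries.coeff k (iwasawaToPowerSeries 2 H)‖ ≤ 1 := by
  rw [iwasawaToPowerSeries, PowerSeries.coeff_map, PadicInt.algebraMap_apply]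
  exact PadicInt.norm_le_one _

/-- **(★-EisFin) — the Eisenstein half of (★) in FINITE-LEVEL form** (no elliptic curve; no `2`-adic limit of the
unsmoothed measure). For odd `N`, admissible `β` and ANY nonzero `Λ`-multiples `G₀`, `G₀^ι` of the `2`-adic Kubota–Leopoldt
numerators `G = klTwoNumerator`, `G^ι = klTwoNumeratorInv`, there are `H ∈ Λ` and `e ∈ ℤ₂` with
(i) for every `k`, eventually in `n`: the `k`-th Riemann sum of the STEVENS-SMOOTHED `C`-normalised Eisenstein measure in the
`8`-normalisation, `Sm_5^5(eisNormMeasure N β 8)`, is congruent to `[T^k] ι H` modulo `2ℤ₂` (`‖·‖₂ ≤ 2⁻¹`); and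
(ii) `red H = red((1+T)^e)·red(pfree G₀)·red(pfree G₀^ι)·∏_{ℓ ∣ N} red(γ_ℓ − 1)^{ord_ℓ N}` in `𝔽₂⟦T⟧`.
(`H = L_Λ·½G^ι·½G` with `L_Λ = ∑_{t∣N} c_tχ₋₄(t)(1+T)^{−f_t}`, `e = −∑_ℓ ord_ℓ(N) f_ℓ`; mechanism: pointwise
`Sm ν₈ ≡ −(3/2)·Sm E (mod 2ℤ₂)` (`norm_stevensSmoothing_eisNormMeasure_add_le`), `η = +1` half of the even measure `Sm E`,
`L(Sm E) = L_Λ·G^ι·G = 4·ι H` (lit's `distributionTransform_smoothedEisensteinDedekindTwo`), `−3 ≡ 1`, `4ℤ₂ ⊂ 2ℤ₂`.)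
Together with a mod-2 cusp congruence in the `8`-normalisation and the transform of `Sm_5^5 μ_f` this yields (★-core)
(evidence #39 on the item). [cite: Stevens1982, §5.4 Prop. 5.4.1 and PDF p. 74] [cite: MazurTateTeitelbaum1986Invent, §I.10–I.13]
[cite: GreenbergVatsal2000, §3 Thm. (3.12), (28)] -/
theorem starEisFin (N : ℕ) (hodd : Odd N) (β : ℕ → ℕ) (hadm : IsAdmissibleStabData N β)
    (cg : ℚ_[2]) (G₀ : IwasawaAlgebra 2) (hG₀ : G₀ ≠ 0)
    (hιG : iwasawaToPowerSeries 2 G₀ = PowerSeries.C cg * klTwoNumerator)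
    (ci : ℚ_[2]) (GI₀ : IwasawaAlgebra 2) (hGI₀ : GI₀ ≠ 0)
    (hιGI : iwasawaToPowerSeries 2 GI₀ = PowerSeries.C ci * klTwoNumeratorInv) :
    ∃ (H : IwasawaAlgebra 2) (e : ℤ_[2]),
      (∀ k : ℕ, ∀ᶠ n in atTop,
        ‖distributionRiemannSum (stevensSmoothing 5 (eisNormMeasure N β 8)) k n -
            PowerSeries.coeff k (iwasawaToPowerSeries 2 H)‖ ≤ 2⁻¹) ∧
      red H = red (PowerSeries.binomialSeries ℤ_[2] e) * red (pfree G₀) * red (pfree GI₀) *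
        ∏ ℓ ∈ N.primeFactors, red (frobeniusSeries 2 ℓ - 1) ^ N.factorization ℓ := by
  classical
  have hT : ∀ t ∈ N.divisors, Odd t := fun t ht ↦ hodd.of_dvd_nat (Nat.dvd_of_mem_divisors ht)
  -- the Kubota–Leopoldt half-lifts
  obtain ⟨G₀', hG₀', hG₀'c⟩ := exists_iwasawa_half_klTwoNumerator
  obtain ⟨GI₀', hGI₀', hGI₀'c⟩ := exists_iwasawa_half_klTwoNumeratorInv
  -- the stabilisation coefficients in `ℤ₂` and the level element
  set z : ℕ → ℤ_[2] := fun t ↦ ⟨((stabCoeff N β t : ℚ) : ℚ_[2]), norm_stabCoeff_le_one hodd t⟩ with hz_def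
  have hz : ∀ t, (z t : ℚ_[2]) = ((stabCoeff N β t : ℚ) : ℚ_[2]) := fun t ↦ rfl
  set L : IwasawaAlgebra 2 := ∑ t ∈ N.divisors, PowerSeries.C (z t * chiMinusFour 2 t) *
    PowerSeries.binomialSeries ℤ_[2] (-(frobeniusExponent 2 (t : ℤ_[2]))) with hL_def
  refine ⟨L * GI₀' * G₀', -(∑ ℓ ∈ N.primeFactors, (N.factorization ℓ : ℤ_[2]) * frobeniusExponent 2 (ℓ : ℤ_[2])),
    fun k ↦ ?_, ?_⟩
  · -- (i) the Riemann sums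
    set smE := smoothedEisensteinDedekindTwo N.divisors (stabCoeff N β) with hsmE
    have hlim : Tendsto (distributionRiemannSum smE k) atTop
        (𝓝 (PowerSeries.coeff k (distributionTransform smE))) :=
      tendsto_distributionRiemannSum (smoothedEisensteinDedekindTwo_distribution N.divisors (stabCoeff N β) hT)
        (norm_smoothedEisensteinDedekindTwo_le N.divisors (stabCoeff N β)) k
    -- Teichmüller–exponent data for the odd levels `t ∣ N`
    let η : ℕ → rootsOfUnity (torsionOrder 2) ℤ_[2] := fun t ↦
      if h : t.Coprime 2 then Classical.choose (exists_teichmuller_frobeniusExponent (p := 2) h) else 1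
    have hcf : ∀ t ∈ N.divisors, ∀ n : ℕ, PadicInt.toZModPow (n + cyclotomicExponent 2) ((η t : ℤ_[2]ˣ) : ℤ_[2]) *
        (cyclotomicGenerator 2 : ZMod (2 ^ (n + cyclotomicExponent 2))) ^
          (PadicInt.toZModPow n (frobeniusExponent 2 (t : ℤ_[2]))).val =
        (t : ZMod (2 ^ (n + cyclotomicExponent 2))) := by
      intro t ht n
      have hc : t.Coprime 2 := Nat.coprime_two_right.mpr (hT t ht)
      simp only [η, dif_pos hc]
      exact Classical.choose_spec (exists_teichmuller_frobeniusExponent (p := 2) hc) n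
    have hLsmE := distributionTransform_smoothedEisensteinDedekindTwo N.divisors (stabCoeff N β)
      (η := η) (f := fun t ↦ frobeniusExponent 2 (t : ℤ_[2])) hcf hT
    -- `L(Sm E) = 4 · ι(L · G₀^ι' · G₀')`
    have hιL : iwasawaToPowerSeries 2 L = ∑ t ∈ N.divisors,
        PowerSeries.C ((stabCoeff N β t : ℚ_[2]) * ((chiMinusFour 2 t : ℤ_[2]) : ℚ_[2])) *
          PowerSeries.binomialSeries ℚ_[2] (-(frobeniusExponent 2 (t : ℤ_[2]))) := by
      rw [hL_def, map_sum]
      refine Finset.sum_congr rfl fun t _ ↦ ?_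
      rw [map_mul, iwasawaToPowerSeries_binomialSeries]
      congr 1
      rw [iwasawaToPowerSeries, PowerSeries.map_C, map_mul, PadicInt.algebraMap_apply, PadicInt.algebraMap_apply, hz]
    have hC2 : PowerSeries.C (2 : ℚ_[2]) * PowerSeries.C (2⁻¹ : ℚ_[2]) = 1 := by
      rw [← map_mul, mul_inv_cancel₀ (two_ne_zero), map_one]
    have hkl : klTwoNumerator = PowerSeries.C (2 : ℚ_[2]) * iwasawaToPowerSeries 2 G₀' := by
      rw [hG₀', ← mul_assoc, hC2, one_mul]
    have hklI : klTwoNumeratorInv = PowerSeries.C (2 : ℚ_[2]) * iwasawaToPowerSeries 2 GI₀' := by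
      rw [hGI₀', ← mul_assoc, hC2, one_mul]
    have hLval : distributionTransform smE = PowerSeries.C (4 : ℚ_[2]) * iwasawaToPowerSeries 2 (L * GI₀' * G₀') := by
      rw [hsmE, hLsmE, ← hιL, hklI, hkl, map_mul, map_mul, show (4 : ℚ_[2]) = 2 * 2 by norm_num, map_mul]
      ring
    have hcoeff : PowerSeries.coeff k (distributionTransform smE) =
        4 * PowerSeries.coeff k (iwasawaToPowerSeries 2 (L * GI₀' * G₀')) := by
      rw [hLval, PowerSeries.coeff_C_mul]
    set c := PowerSeries.coeff k (iwasawaToPowerSeries 2 (L * GI₀' * G₀')) with hc_def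
    -- eventually `‖(3/4)·RS(Sm E) − 3c‖ ≤ 2⁻¹`
    have hev : ∀ᶠ n in atTop, ‖(3 / 4 : ℚ_[2]) * distributionRiemannSum smE k n - 3 * c‖ ≤ 2⁻¹ := by
      have h := (hlim.const_mul (3 / 4 : ℚ_[2]))
      rw [hcoeff, show (3 / 4 : ℚ_[2]) * (4 * c) = 3 * c by ring] at h
      have := (Metric.tendsto_nhds.mp h) 2⁻¹ (by norm_num)
      exact this.mono fun n hn ↦ by rw [dist_eq_norm] at hn; exact hn.le
    filter_upwards [hev, eventually_ge_atTop 2] with n hn h2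
    have hE1 := norm_distributionRiemannSum_stevensSmoothing_add_le hodd hadm k h2
    have hc1 : ‖c‖ ≤ 1 := norm_coeff_iwasawaToPowerSeries_le_one _ k
    have h4 : ‖(4 : ℚ_[2]) * c‖ ≤ 2⁻¹ := by
      rw [norm_mul, show (4 : ℚ_[2]) = ((2 : ℕ) : ℚ_[2]) ^ 2 by norm_num, Padic.norm_p_pow]
      calc ((2 : ℕ) : ℝ) ^ (-(2 : ℕ) : ℤ) * ‖c‖ ≤ ((2 : ℕ) : ℝ) ^ (-(2 : ℕ) : ℤ) * 1 := by gcongr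
        _ ≤ 2⁻¹ := by norm_num
    have key : distributionRiemannSum (stevensSmoothing 5 (eisNormMeasure N β 8)) k n - c =
        (distributionRiemannSum (stevensSmoothing 5 (eisNormMeasure N β 8)) k n +
            (3 / 4 : ℚ_[2]) * distributionRiemannSum smE k n) -
          ((3 / 4 : ℚ_[2]) * distributionRiemannSum smE k n - 3 * c) - 4 * c := by ring
    rw [key]
    have hsub : ∀ {x y : ℚ_[2]}, ‖x‖ ≤ 2⁻¹ → ‖y‖ ≤ 2⁻¹ → ‖x - y‖ ≤ 2⁻¹ := fun {x y} hx hy ↦ by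
      rw [sub_eq_add_neg]
      exact (Padic.nonarchimedean _ _).trans (max_le hx (by rwa [norm_neg]))
    exact hsub (hsub hE1 hn) h4
  · -- (ii) the reduction
    have hredG : red G₀' ≠ 0 := red_ne_zero_of_constantCoeff_eq_one hG₀'c
    have hredGI : red GI₀' ≠ 0 := red_ne_zero_of_constantCoeff_eq_one hGI₀'c
    rw [red_pfree_eq_red_two hG₀ hιG hG₀' hredG, red_pfree_eq_red_two hGI₀ hιGI hGI₀' hredGI, red_mul', red_mul',
      red_levelElement hodd hadm z hz]
    ring

end Main

end Summit.BirchSwinnertonDyer.BirchSwinnertonDyer.Theorems.DepletionAtTwo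

end
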